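import Literature.NumberTheory.EllipticCurves.Kato2004.EllipticUnitZetaClassComparisonExact
import HarnessLib

/-!
# `F-P1-EXACT′`: `F-P1-EXACT` (`CM.kato15161_ellipticUnitClass_res_zetaFamily_exact`, p827705) with the CM endomorphism allowed to be
# `φ = c·√−p`, `φ ∘ φ = [−p·c²]`, `p ∤ c` (instead of `φ ∘ φ = [−p]`) — the SAME printed statement, the binder the consumer can feed
# (`β ∘ φ ∘ α` on the partner has square `[−7e²]`, `e ∈ {1, 2}`), and the kernel implication `exact′ → exact` (`c = 1`)

Topic `NumberTheory/EllipticCurves`, sub-directory `Kato2004`, namespace `…Kato2004.CM`.  ONE named fact (`def … : Prop`, D-0014) whose text of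
record — print, derivation (D1)–(D7), the period identity, scope, «WHAT THIS IS NOT» — is VERBATIM that of
`Kato2004/EllipticUnitZetaClassComparisonExact.lean` (read it there; nothing is re-derived here), and ONE theorem
`kato15161_ellipticUnitClass_res_zetaFamily_exact_of_exact'` (`exact′ → exact`, by `c = 1`).  Cell bsd-cm, seat bsd-cm-k-ty1 g36; reason
(said once, honestly): the g36 letter `exact` specialised Kato's statement to `φ ∘ φ = [−p]`; the consumer (K-2★) feeds `F-P1` at the
maximal-order partner `W₂` with the composite endomorphism `φ₂ := β ∘ φ ∘ α` (`RamifiedSevenGenusPartnerFP1.lean` l.269–292: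
`φ₂ ∘ φ₂ = [−7·e²]`), for which `m = −7e²`, `e ∈ {1, 2}` — so the binder must read `m = −p·c²`, `p ∤ c`.  NOTHING in the content changes:
`ℤ_p[c√−p] = ℤ_p[√−p] = O_K ⊗ ℤ_p` (`c` a unit), `𝔭 = (√−p)`, the generator condition `φ(e₁) ≠ 0 ⟺ √−p·e₁ ≠ 0` (`c` is invertible on
`W[p]`), and `v_p(Nm(α₀ + α₁φ)) = v_p(α₀² + p·c²·α₁²) = min(2v(α₀), 1 + 2v(α₁)) = v_p(α₀² + p·α₁²)` — so the clause (E) is kept LETTER FOR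
LETTER (`(α₀ ^ 2 + p * α₁ ^ 2).valuation`).  Σ-covariance: as `exact` (reading note §2), plus `c ↦ −c` / `c ↦ c·u` (`p ∤ u`) invisible.
Debt: +1 (this def); `exact` becomes its corollary (`…_exact_of_exact'`).  No instance, no notation, no `sorry`.
HONEST LABEL: a re-binder of a transcription; nothing about any member's lattice type; 19945 OPEN; no summit statement touched; BSD claimed
for no curve.
[cite: Kato2004Asterisque, §15.16 (15.16.1) (p. 265 l. 30–37), Lemma 15.11 (2) (pp. 261–262), Prop. 15.9 (pp. 258–259), Thm. 12.5 (1) (p. 221)]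

## References
* [Kato2004Asterisque] K. Kato, Astérisque 295 (2004), as in `EllipticUnitZetaClassComparisonExact.lean`.
* [SilvermanAEC2009] J. H. Silverman, *The Arithmetic of Elliptic Curves*, Thm. VI.5.1 / Prop. VI.3.6 (b), C.16; [CremonaAlgorithms1997] §3.7.
* Tree: `Kato2004/EllipticUnitZetaClassComparisonExact.lean` (p827705; text of record), `Kato2004/EllipticUnitZetaClassComparison.lean` (F-P1).
-/

noncomputable section

open scoped BigOperators NumberField TensorProduct Classical
open Field IsDedekindDomain NumberField CongruenceSubgroup ValuativeRel
open Literature.NumberTheory.GaloisRepresentations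
open Literature.NumberTheory.GaloisRepresentations.PeriodRingData
open Literature.NumberTheory.GaloisRepresentations.IsNonarchimedeanLocalField
open Literature.NumberTheory.PAdicHodge
open Literature.NumberTheory.EllipticCurves Literature.NumberTheory.EllipticCurves.ModularForms
open Literature.NumberTheory.AdelicBaseChange Literature.NumberTheory.Automorphic
open Literature.NumberTheory.ComplexMultiplication.EllipticUnits
open WeierstrassCurve (geomPoints geomTorsion)

namespace Literature.NumberTheory.EllipticCurves.Kato2004

open EulerSystemValues Rat.HeightOneSpectrum

namespace CM

set_option backward.isDefEq.respectTransparency false in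
/-- **`F-P1-EXACT′` — Kato 2004 (15.16.1) with the constant named, CM endomorphism `φ` with `φ ∘ φ = [−p·c²]`, `p ∤ c`.**  Binders and
conclusion VERBATIM those of `kato15161_ellipticUnitClass_res_zetaFamily_exact` (p827705) except that `m = −p` is replaced by
`m = −p·c²` for some `c : ℤ` with `p ∤ c` (`φ = c·√−p`; `ℤ_p[φ] = O_K ⊗ ℤ_p`; clause (E) unchanged since
`v_p(α₀² + pc²α₁²) = v_p(α₀² + pα₁²)`).  Text of record: the module docstring of `EllipticUnitZetaClassComparisonExact.lean` (derivation
(D1)–(D7), period identity, scope).  Named fact; nothing asserted; no `_holds` expected.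
[cite: Kato2004Asterisque, §15.16 (15.16.1) (p. 265 l. 30–37), Lemma 15.11 (2) with (15.11.3) (pp. 261–262), Prop. 15.9 / (15.9.1) (pp. 258–259), §15.8 (15.8.1) (p. 257), Thm. 12.5 (1) (p. 221), Thm. 12.4 (2) (p. 221), §13.9 (p. 230 l. 8–9), Lemma 13.10 (1) (p. 230), §15.6 (15.6.1)–(15.6.3) (p. 254), §15.12 (15.12.1) (p. 263), 15.14 (p. 264)]
[cite: SilvermanAEC2009, Thm. VI.5.1 and Prop. VI.3.6 (b)] [cite: CremonaAlgorithms1997, §3.7] -/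
def kato15161_ellipticUnitClass_res_zetaFamily_exact' : Prop :=
  ∀ (W : WeierstrassCurve ℚ) [W.IsElliptic] [W.IsGloballyMinimal], W.j ∈ maximalCMJInvariants →
  ∀ (K : Type) [Field K] [NumberField K], IsCMFieldOfJ K W.j →
  ∀ (ψ : HeckeCharacter K), ψ.HasInfinityType (fun _ ↦ 1) (fun _ ↦ 0) →
    (∀ s : ℂ, 3 / 2 < s.re → heckeLFunction ψ s = W.LSeries s) →
  ∀ (ι : AlgebraicClosure K →+* ℂ),
    (∀ (w : InfinitePlace K) (x : K), ι (algebraMap K (AlgebraicClosure K) x) = w.embedding x) →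
  ∀ (f : ℕ), 3 ≤ f →
    (∀ α : 𝓞 K, α ≠ 0 → ((f : ℕ) : 𝓞 K) ∣ α - 1 →
      heckeCharIdealValue ψ (Ideal.span {α}) = ι (algebraMap K (AlgebraicClosure K) (α : K))) →
  ∀ (p : ℕ) [Fact p.Prime] [ContinuousSMul ℤ_[p] (W.tateModule p)]
    [ContinuousSMul ℤ_[p] ((W.baseChange K).tateModule p)],
  -- SUPPORT OF `f`: every prime factor of `f` other than `p` is a prime of BAD reduction of `W` (then `ψ` vanishes at every
  -- prime of `K` dividing `f` and prime to `p`, so Prop. 15.9's `L_{p𝔣}` and Thm. 12.5 (1)'s `L_{(p)}` deplete the same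
  -- Euler factors; for a general `f` with `cond ψ ∣ (f)` the two sides below differ by `∏_{𝔩∣f, 𝔩∤p·cond ψ}(1 − ψ̄(𝔩)N𝔩⁻¹σ_𝔩)`)
  (∀ (ℓ : ℕ) [Fact ℓ.Prime], ℓ ∣ f → ℓ ≠ p → ¬ W.HasGoodReductionAtPrime ℓ) →
  -- the `ℚ`-side pin: a cyclotomic `ℤ_p`-extension of `ℚ`, a topological generator, the Δ-trivial Iwasawa cohomology
  ∀ (κ : ZpExtension ℚ p) (hκ : κ.IsCyclotomic) (γ : absoluteGaloisGroup ℚ) (hγ : κ.IsTopGenerator γ)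
    (I : IwasawaH1Data W p κ γ),
  -- the `K`-side pin: the restricted tower `Kℚ_∞/K`, a topological generator, the `K`-side Iwasawa cohomology (15.14)
  ∀ (h : Function.Surjective (κ.toContinuousMonoidHom.comp (absGaloisRestrict ℚ K))) (γK : absoluteGaloisGroup K)
    (hγK : (κ.restrict K h).IsTopGenerator γK) (IK : IwasawaH1DataOver (W.baseChange K) p (κ.restrict K h) γK),
  -- the Kummer frame on the ray-class tower (as in `h159′`), `e ≠ 0`, and the cyclotomic layers inside the Kummer levels
  ∀ (F : KummerFrame (W.baseChange K) p),
    (∀ s : ℕ, F.V s = torsionLayer (W.baseChange K) (p ^ s * f)) → (∃ k : ℕ, F.e k ≠ 0) →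
  ∀ (hV : ∀ n : ℕ, F.V (n + 1) ≤ (κ.restrict K h).layerSubgroup n),
  -- the complex multiplication: a `K`-endomorphism `φ` with `φ ∘ φ = [m]`, `m < 0` (so `ℚ(φ) = K` inside `End ⊗ ℚ`)
  ∀ (φ : WeierstrassCurve.Isogeny (W.baseChange K) (W.baseChange K)) (m : ℤ), m < 0 →
    (∀ P : geomPoints (W.baseChange K), φ (φ P) = m • P) →
  -- (EXACT′): `φ ∘ φ = [−p·c²]` with `p ∤ c` — `φ = c·√−p`, `ℤ_p[φ] = O_K ⊗ ℤ_p`, `𝔭 = (√−p)` ramified, `v_p Nm(α₀ + α₁φ) = v_p(α₀² + pα₁²)`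
  -- (the consumer's partner endomorphism `β ∘ φ ∘ α` has square `[−7e²]`, `e ∈ {1, 2}`; `exact` is the case `c = 1`)
  ∀ (cφ : ℤ), ¬ (p : ℤ) ∣ cφ → m = -(p : ℤ) * cφ ^ 2 →
  -- NEW (EXACT): the frame's torsion generator is an `O_K ⊗ ℤ_p`-GENERATOR of `T_p(W_K)` (`e₁ ∉ W[𝔭] = ker φ = 𝔭T/pT`;
  -- the record's `good`); for `e = π^m·ε·γ_gen` the constant below would shift by `π^m` (Σ-table (g1′))
  φ ((F.e 1 : geomTorsion (W.baseChange K) ((p : ℤ) ^ 1)) : geomPoints (W.baseChange K)) ≠ 0 →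
  -- NEW (EXACT): the BETTI antecedents defining the closed constant `κ′_W ∈ K^×` — a Néron lattice `Λ_W = L.lattice` of the
  -- (globally minimal) model, an `O_K`-generator `λ₀` of it (`Λ_W = λ₀·ι(O_K)`; class number one), a square root `s` of `−p`
  -- in `K` (a generator of the different `𝔡_{K/ℚ} = 𝔭`, `p ≡ 3 mod 4`; for `p ≡ 1 mod 4` it is off by the `p`-unit `2`), and
  -- `κ′` with `ι(κ′)·Ω_W = ι(s)·λ₀` (`Ω_W = W.realPeriodRat = c_∞·Ω₁`): PINS ONLY AS ANTECEDENTS (critic NOTE #28 item 8)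
  ∀ (L : PeriodPair), IsNeronLatticeOf (W.baseChange ℂ) L →
  ∀ (lam0 : ℂ), (∀ z : ℂ, z ∈ L.lattice ↔ ∃ a : 𝓞 K, z = lam0 * ι (algebraMap K (AlgebraicClosure K) (a : K))) →
  ∀ (sr : K), sr ^ 2 = -(p : K) →
  ∀ (κ' : K), ι (algebraMap K (AlgebraicClosure K) κ') * ((W.realPeriodRat : ℝ) : ℂ) =
      ι (algebraMap K (AlgebraicClosure K) sr) * lam0 →
  -- ONE REALISED value-pinned family: VERBATIM the binders (A0)–(A4), (A5′), (A6′-scalars) of `HasRealisedZetaFamilyBody`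
  -- (CLOSED form: the `ℤ_p`-structure facts of `T_pW` supplied by the tree theorems, as in `ZetaClassPosition`)
  letI : Module.Free ℤ_[p] (W.tateModule p) := W.module_free_tateModule_holds p
  letI : Module.Finite ℤ_[p] (W.tateModule p) := W.module_finite_tateModule_holds p
  letI ρT := restrictedTateRep W (NumberField.Place.Completion (Sum.inr ((Rat.HeightOneSpectrum.primesEquiv (R := 𝓞 ℚ)).symm ⟨p, Fact.out⟩) : NumberField.Place ℚ)) p
  letI : ValuativeRel (NumberField.Place.Completion (Sum.inr ((Rat.HeightOneSpectrum.primesEquiv (R := 𝓞 ℚ)).symm ⟨p, Fact.out⟩) : NumberField.Place ℚ)) :=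
    inferInstanceAs (ValuativeRel (((Rat.HeightOneSpectrum.primesEquiv (R := 𝓞 ℚ)).symm ⟨p, Fact.out⟩).adicCompletion ℚ))
  letI : TopologicalSpace (NumberField.Place.Completion (Sum.inr ((Rat.HeightOneSpectrum.primesEquiv (R := 𝓞 ℚ)).symm ⟨p, Fact.out⟩) : NumberField.Place ℚ)) :=
    inferInstanceAs (TopologicalSpace (((Rat.HeightOneSpectrum.primesEquiv (R := 𝓞 ℚ)).symm ⟨p, Fact.out⟩).adicCompletion ℚ))
  haveI : IsNonarchimedeanLocalField (NumberField.Place.Completion (Sum.inr ((Rat.HeightOneSpectrum.primesEquiv (R := 𝓞 ℚ)).symm ⟨p, Fact.out⟩) : NumberField.Place ℚ)) :=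
    inferInstanceAs (IsNonarchimedeanLocalField (((Rat.HeightOneSpectrum.primesEquiv (R := 𝓞 ℚ)).symm ⟨p, Fact.out⟩).adicCompletion ℚ))
  haveI : CharZero (NumberField.Place.Completion (Sum.inr ((Rat.HeightOneSpectrum.primesEquiv (R := 𝓞 ℚ)).symm ⟨p, Fact.out⟩) : NumberField.Place ℚ)) := LocalField.charZero_adicCompletion ((Rat.HeightOneSpectrum.primesEquiv (R := 𝓞 ℚ)).symm ⟨p, Fact.out⟩)
  letI : Algebra ℚ_[p] (NumberField.Place.Completion (Sum.inr ((Rat.HeightOneSpectrum.primesEquiv (R := 𝓞 ℚ)).symm ⟨p, Fact.out⟩) : NumberField.Place ℚ)) :=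
    LocalField.adicCompletionPadicAlgebra ((Rat.HeightOneSpectrum.primesEquiv (R := 𝓞 ℚ)).symm ⟨p, Fact.out⟩) p ((natCast_mem_asIdeal_iff_eq_primesEquiv_symm _ (Fact.out : p.Prime)).mpr rfl)
  haveI : Fact (¬ IsUnit ((p : ℕ) : integerC (NumberField.Place.Completion (Sum.inr ((Rat.HeightOneSpectrum.primesEquiv (R := 𝓞 ℚ)).symm ⟨p, Fact.out⟩) : NumberField.Place ℚ)))) :=
    ⟨not_isUnit_natCast_integerC (show valuation (NumberField.Place.Completion (Sum.inr ((Rat.HeightOneSpectrum.primesEquiv (R := 𝓞 ℚ)).symm ⟨p, Fact.out⟩) : NumberField.Place ℚ)) ((p : ℕ) : (NumberField.Place.Completion (Sum.inr ((Rat.HeightOneSpectrum.primesEquiv (R := 𝓞 ℚ)).symm ⟨p, Fact.out⟩) : NumberField.Place ℚ))) < 1 from LocalField.valuation_adicCompletion_natCast_lt_one ((Rat.HeightOneSpectrum.primesEquiv (R := 𝓞 ℚ)).symm ⟨p, Fact.out⟩) p ((natCast_mem_asIdeal_iff_eq_primesEquiv_symm _ (Fact.out : p.Prime)).mpr rfl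))⟩
  haveI := isAdicComplete_integerC_natCast (show valuation (NumberField.Place.Completion (Sum.inr ((Rat.HeightOneSpectrum.primesEquiv (R := 𝓞 ℚ)).symm ⟨p, Fact.out⟩) : NumberField.Place ℚ)) ((p : ℕ) : (NumberField.Place.Completion (Sum.inr ((Rat.HeightOneSpectrum.primesEquiv (R := 𝓞 ℚ)).symm ⟨p, Fact.out⟩) : NumberField.Place ℚ))) < 1 from LocalField.valuation_adicCompletion_natCast_lt_one ((Rat.HeightOneSpectrum.primesEquiv (R := 𝓞 ℚ)).symm ⟨p, Fact.out⟩) p ((natCast_mem_asIdeal_iff_eq_primesEquiv_symm _ (Fact.out : p.Prime)).mpr rfl))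
  -- the tree's `ℚ`-algebra structure on `ℚ_v` (the one W2's restricted representations are built on) is pinned
  -- as the most recent local instance, so that it — and not `DivisionRing.toRatAlgebra` — is synthesized below
  letI : Algebra ℚ (NumberField.Place.Completion (Sum.inr ((Rat.HeightOneSpectrum.primesEquiv (R := 𝓞 ℚ)).symm ⟨p, Fact.out⟩) : NumberField.Place ℚ)) := NumberField.Place.instAlgebraCompletion (Sum.inr ((Rat.HeightOneSpectrum.primesEquiv (R := 𝓞 ℚ)).symm ⟨p, Fact.out⟩) : NumberField.Place ℚ)
  ∀ (hp : p ≠ 2) (N : ℕ) (_ : NeZero N) (nf : CuspForm (Gamma0 N) 2) (_ : IsNewformOf W nf)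
    (ιcyc : (n : ℕ) → (CyclotomicField n ℚ →+* ℂ)) (q : ℚ)
    (Λv : ∀ (k : ℕ) (r : Finset (HeightOneSpectrum (𝓞 ℚ))),
      H1 (tateRep W p) (cycSubgroup p k r) →ₗ[ℤ_[p]] ℚ_[p] ⊗[ℚ] CyclotomicField (cycLevel p k r) ℚ),
    -- (A0)
    q ≠ 0 →
    -- (A1) ∧ (A2)
    (∃ d, DefinedExpStarBody W p nf d ιcyc ((q : ℚ) : ℝ) Λv ∧
      ∀ a : (NumberField.Place.Completion (Sum.inr ((Rat.HeightOneSpectrum.primesEquiv (R := 𝓞 ℚ)).symm ⟨p, Fact.out⟩) : NumberField.Place ℚ)),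
        (∃ η : contOneCocycles ρT.toTopRep, expStarCoord W (show valuation (NumberField.Place.Completion (Sum.inr ((Rat.HeightOneSpectrum.primesEquiv (R := 𝓞 ℚ)).symm ⟨p, Fact.out⟩) : NumberField.Place ℚ)) ((p : ℕ) : (NumberField.Place.Completion (Sum.inr ((Rat.HeightOneSpectrum.primesEquiv (R := 𝓞 ℚ)).symm ⟨p, Fact.out⟩) : NumberField.Place ℚ))) < 1 from LocalField.valuation_adicCompletion_natCast_lt_one ((Rat.HeightOneSpectrum.primesEquiv (R := 𝓞 ℚ)).symm ⟨p, Fact.out⟩) p ((natCast_mem_asIdeal_iff_eq_primesEquiv_symm _ (Fact.out : p.Prime)).mpr rfl)) d η = a) ↔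
          ∀ Q : (W.baseChange ℚ_[p]).toAffine.Point,
            ‖(Padic.adicCompletionEquiv (𝓞 ℚ) ⟨p, Fact.out⟩).symm
                (show ((Rat.HeightOneSpectrum.primesEquiv (R := 𝓞 ℚ)).symm ⟨p, Fact.out⟩).adicCompletion ℚ from a) * padicLogLocal W p Q‖ ≤ 1) →
    -- (A3)
    ∀ (c d₁ a : ℤ) (A : ℕ) (d' : ℤ),
      0 < A → Int.gcd c (6 * p * A) = 1 → Int.gcd d₁ (6 * p * N) = 1 → (d₁ : ℤ) * d' ≡ 1 [ZMOD (A : ℤ)] →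
      ratCuspFactor nf true c d₁ a A d' ≠ 0 →
    ∀ (z : ∀ (k : ℕ) (r : (cyclotomicLevelsRat p (badPlaces c d₁ A N)).Ideals),
        H1 (tateRep W p) ((cyclotomicLevelsRat p (badPlaces c d₁ A N)).level k r.1))
      (x : ∀ (k : ℕ) (r : (cyclotomicLevelsRat p (badPlaces c d₁ A N)).Ideals),
        CyclotomicField (cycLevel p k r.1) ℚ),
      ZetaBody W p nf ιcyc ((q : ℚ) : ℝ) Λv c d₁ a A z x →
    -- (A4) the realisation datum: the Λ-adic lift `y ∈ I.H`
    ∀ (y : I.H),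
      (∀ n : ℕ, I.proj n y =
        levelToLayer W p hκ hp (badPlaces c d₁ A N) n
          (z (n + 1) (cyclotomicLevelsRat p (badPlaces c d₁ A N)).idealOne)) →
    -- (A5′) ∧ (A6′-scalars)
    ∀ (qm perRatio : ℚ) (e : ℤ) (n₁ n₂ n₃ n₄ : ℤ) (σc σd : absoluteGaloisGroup ℚ)
      (σℓ : ℕ → absoluteGaloisGroup ℚ),
      0 < qm → AddSubgroup.closure (Set.range (ratMinusSymbol nf)) = AddSubgroup.zmultiples qm →
      ratMinusSymbol nf ((a : ℚ) / A) = n₁ * qm → ratMinusSymbol nf ((a * c : ℚ) / A) = n₂ * qm →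
      ratMinusSymbol nf ((a * d' : ℚ) / A) = n₃ * qm → ratMinusSymbol nf ((a * c * d' : ℚ) / A) = n₄ * qm →
      ((GaloisRep.cyclotomicCharacter ℚ p σc : ℤ_[p]ˣ) : ℤ_[p]) = c →
      ((GaloisRep.cyclotomicCharacter ℚ p σd : ℤ_[p]ˣ) : ℤ_[p]) = d₁ →
      (∀ ℓ ∈ A.primeFactors.erase p, ((GaloisRep.cyclotomicCharacter ℚ p (σℓ ℓ) : ℤ_[p]ˣ) : ℤ_[p]) = ℓ) →
      perRatio ≠ 0 → plusPeriod nf = ((perRatio : ℚ) : ℝ) * W.realPeriodRat →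
      padicValRat p (perRatio / (q * qm)) = e →
    -- CONCLUSION: ONE constant `p^{-t}·(α₀ + α₁φ)·w` for the frame, the endomorphism and the family …
    ∃ (t : ℕ) (α₀ α₁ : ℤ_[p]) (_ : α₀ ≠ 0 ∨ α₁ ≠ 0) (w : (IwasawaAlgebra p)ˣ),
      -- … such that for EVERY admissible twist, EVERY pinned unit tower and ALL coordinates of `[ε_𝔟]` on the `e_k` …
      (∀ 𝔟 : Ideal (𝓞 K), IsCoprime 𝔟 (Ideal.span {((6 * p * f : ℕ) : 𝓞 K)}) →
      ∀ u : F.UnitTower, (∀ s : ℕ, 1 ≤ s → IsKatoUnitRepAt p ι (Ideal.span {((f : ℕ) : 𝓞 K)}) s 𝔟 (u.z s)) →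
      ∀ (b₀ b₁ : ℤ) (Nb : ℕ), Nb ≠ 0 →
        (∀ k s : ℕ, k ≤ s → 1 ≤ s →
          (Nb : ℤ) • ((layerArtin p (Ideal.span {((f : ℕ) : 𝓞 K)}) s 𝔟 • F.e k :
              geomTorsion (W.baseChange K) ((p : ℤ) ^ k)) : geomPoints (W.baseChange K)) =
            b₀ • ((F.e k : geomTorsion (W.baseChange K) ((p : ℤ) ^ k)) : geomPoints (W.baseChange K)) +
              b₁ • φ ((F.e k : geomTorsion (W.baseChange K) ((p : ℤ) ^ k)) : geomPoints (W.baseChange K))) →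
        -- … (15.16.1) after `⊗ ℚ`: `[ε_𝔟]·(p^t M̃)·euK 𝔟 = N𝔟·([ε_𝔟] − σ_𝔟)·(α₀ + α₁φ)·w·res y` (times `N_b`), in `IK.H`
        ((b₀ : IwasawaAlgebra p) * ((p : IwasawaAlgebra p) ^ t *
            katoMultiplier p c d₁ n₁ n₂ n₃ n₄
              ((IwasawaCharacter.Psi p ℤ_[p] κ σc : (PowerSeries ℤ_[p])ˣ) : IwasawaAlgebra p)
              ((IwasawaCharacter.Psi p ℤ_[p] κ σd : (PowerSeries ℤ_[p])ˣ) : IwasawaAlgebra p)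
              (A.primeFactors.erase p) (fun ℓ => W.LFunction ℓ) (fun ℓ => if ℓ ∣ N then 0 else 1)
              (fun ℓ => ((IwasawaCharacter.Psi p ℤ_[p] κ (σℓ ℓ) : (PowerSeries ℤ_[p])ˣ) : IwasawaAlgebra p)))) •
            F.iwasawaClass u (κ.restrict K h) hV IK +
          ((b₁ : IwasawaAlgebra p) * ((p : IwasawaAlgebra p) ^ t *
            katoMultiplier p c d₁ n₁ n₂ n₃ n₄
              ((IwasawaCharacter.Psi p ℤ_[p] κ σc : (PowerSeries ℤ_[p])ˣ) : IwasawaAlgebra p)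
              ((IwasawaCharacter.Psi p ℤ_[p] κ σd : (PowerSeries ℤ_[p])ˣ) : IwasawaAlgebra p)
              (A.primeFactors.erase p) (fun ℓ => W.LFunction ℓ) (fun ℓ => if ℓ ∣ N then 0 else 1)
              (fun ℓ => ((IwasawaCharacter.Psi p ℤ_[p] κ (σℓ ℓ) : (PowerSeries ℤ_[p])ˣ) : IwasawaAlgebra p)))) •
            IK.isogenyMap φ IK hγK (F.iwasawaClass u (κ.restrict K h) hV IK) =
        ((Ideal.absNorm 𝔟 : ℕ) : IwasawaAlgebra p) •
          ((((b₀ : IwasawaAlgebra p) -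
              (Nb : IwasawaAlgebra p) * PowerSeries.binomialSeries ℤ_[p] (ZpExtension.artinExponent (κ.restrict K h) 𝔟)) •
              ((PowerSeries.C α₀ : IwasawaAlgebra p) • ((w : IwasawaAlgebra p) • I.resOver IK hγ hγK y) +
                (PowerSeries.C α₁ : IwasawaAlgebra p) •
                  IK.isogenyMap φ IK hγK ((w : IwasawaAlgebra p) • I.resOver IK hγ hγK y))) +
            (b₁ : IwasawaAlgebra p) •
              IK.isogenyMap φ IK hγK
                ((PowerSeries.C α₀ : IwasawaAlgebra p) • ((w : IwasawaAlgebra p) • I.resOver IK hγ hγK y) +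
                  (PowerSeries.C α₁ : IwasawaAlgebra p) •
                    IK.isogenyMap φ IK hγK ((w : IwasawaAlgebra p) • I.resOver IK hγ hγK y)))) ∧
      -- NEW (EXACT): Kato's (15.16.1) IS exact — the constant is a 𝔭-ADIC UNIT times `p^{e}/κ′_W` ((★E) of the module
      -- docstring), stated in NORM form: `v_p(Nm(α₀ + α₁φ)) = 2t + 2e − v_p(Nm_{K/ℚ} κ′_W)`
      (((α₀ ^ 2 + (p : ℤ_[p]) * α₁ ^ 2).valuation : ℕ) : ℤ) = 2 * (t : ℤ) + 2 * e - padicValRat p (Algebra.norm ℚ κ')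

/-- **`F-P1-EXACT′ ⇒ F-P1-EXACT`** (`c = 1`). [cite: Kato2004Asterisque, §15.16 (15.16.1) (p. 265)] -/
theorem kato15161_ellipticUnitClass_res_zetaFamily_exact_of_exact'
    (h : kato15161_ellipticUnitClass_res_zetaFamily_exact') : kato15161_ellipticUnitClass_res_zetaFamily_exact := by
  intro W _ _ hj K _ _ hKj ψ hψ hLψ ι hι f hf hcond p _ _ _ hsupp κ hκ γ hγ I hs γK hγK IK F hFV heF hV φ m hm hφ hmp hgen
  have h1 : ¬ (p : ℤ) ∣ (1 : ℤ) := fun hd ↦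
    (Fact.out : p.Prime).ne_one (by exact_mod_cast Int.eq_one_of_dvd_one (Int.natCast_nonneg p) hd)
  have hm1 : m = -(p : ℤ) * (1 : ℤ) ^ 2 := by rw [hmp]; ring
  exact h W hj K hKj ψ hψ hLψ ι hι f hf hcond p hsupp κ hκ γ hγ I hs γK hγK IK F hFV heF hV φ m hm hφ 1 h1 hm1 hgen

end CM

end Literature.NumberTheory.EllipticCurves.Kato2004

end
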